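import Mathlib
import Summits.Ventures.HodgeRepro2.T5DegreeOneNumberField

/-!
# T5DegreeOneValued — `F_𝔭 ≃ ℚ_p` is an isomorphism of VALUED fields

Tier-5 kernel support (seat p7), file (7) of the chain behind route/T5-LEAN-p7.md §22 (fourth /
fifth addendum): the ring isomorphisms of `T5DegreeOneCompletion` / `T5DegreeOneNumberField`
respect the valuations on the WHOLE completion, not only on the dense subfield `K` and not only on
the unit ball: for every `n : ℤ`, `‖e x‖ ≤ p ^ n ↔ Valued.v x ≤ exp n` (`withValRingEquiv_norm_le_iff`;
closed balls on both sides are clopen and the two conditions agree on the dense image of `K` by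
`valuation_le_exp_iff`), hence `Padic.mulValuation (e x) = Valued.v x` for every `x`
(`mulValuation_withValRingEquiv`, `comap_mulValuation_adicCompletionRingEquiv`,
`comap_mulValuation_completionEquivPadic`): the `w`-adic valuation of the completion IS the
pull-back of the `p`-adic valuation of `ℚ_[p]`, i.e. `completionEquivPadic` is an isomorphism of
valued fields. Also `norm_completionEquivPadic_eq_zpow_log` (the norm on `F_𝔭` through `ℚ_[p]`).

Setting as in the chain; Mathlib only beyond it.
-/

namespace Summit.Ventures.HodgeRepro2.T5DegreeOneValued

open Ideal IsDedekindDomain WithZero UniformSpace NumberField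
open Summit.Ventures.HodgeRepro2.T5DegreeOneQuotient Summit.Ventures.HodgeRepro2.T5DegreeOnePadicInt
  Summit.Ventures.HodgeRepro2.T5DegreeOnePadic Summit.Ventures.HodgeRepro2.T5DegreeOneCompletion
  Summit.Ventures.HodgeRepro2.T5DegreeOneIntegers Summit.Ventures.HodgeRepro2.T5DegreeOneNumberField

section Discrete

/-- Two elements of the discrete value group `ℤᵐ⁰` bounded by the same `exp n` for every `n : ℤ`
are equal. -/
theorem eq_of_forall_le_exp_iff {u u' : ℤᵐ⁰} (h : ∀ n : ℤ, u ≤ exp n ↔ u' ≤ exp n) : u = u' := by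
  have key : ∀ {a b : ℤᵐ⁰}, (∀ n : ℤ, a ≤ exp n → b ≤ exp n) → b ≤ a := by
    intro a b hab
    rcases eq_or_ne a 0 with rfl | ha0
    · by_contra hne
      have hb0 : b ≠ 0 := fun h0 => hne (le_of_eq h0)
      have := (log_le_iff_le_exp hb0).mpr (hab (log b - 1) zero_le)
      omega
    · rcases eq_or_ne b 0 with rfl | hb0
      · exact zero_le
      · have := (log_le_iff_le_exp hb0).mpr (hab (log a) (le_of_eq (exp_log ha0).symm))
        rw [← exp_log ha0, ← exp_log hb0, exp_le_exp]
        exact this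
  exact le_antisymm (key fun n => (h n).mpr) (key fun n => (h n).mp)

end Discrete

variable {R : Type*} [CommRing R] [IsDedekindDomain R] {K : Type*} [Field K] [Algebra R K]
  [IsFractionRing R K] (w : HeightOneSpectrum R) {p : ℕ} [hp : Fact p.Prime]
  (hpP : (p : R) ∈ w.asIdeal) (hpP2 : (p : R) ∉ w.asIdeal ^ 2)
  (hsurj : ∀ x : R, ∃ a : ℤ, x - a ∈ w.asIdeal)
include hpP hpP2 hsurj

omit hp hsurj in
/-- The element `p ^ (-n)` of the completion has valuation `exp n`. -/
theorem valued_coe_natCast_zpow (n : ℤ) :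
    Valued.v (((WithVal.toVal (w.valuation K) (p : K)) : (w.valuation K).Completion) ^ (-n)) =
      (exp n : ℤᵐ⁰) := by
  rw [map_zpow₀, Valued.valuedCompletion_apply, WithVal.valued_toVal]
  have h : w.valuation K (p : K) = exp (-1 : ℤ) := by
    have := intValuation_natCast_eq w.ne_bot hpP hpP2
    rw [← HeightOneSpectrum.valuation_of_algebraMap (K := K)] at this
    simpa using this
  rw [h, ← exp_zsmul, exp_inj]
  simp

/-- On the completion, `‖withValRingEquiv x‖ ≤ p ^ n ↔ Valued.v x ≤ exp n` for every `n : ℤ`. -/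
theorem withValRingEquiv_norm_le_iff (n : ℤ) (x : (w.valuation K).Completion) :
    ‖withValRingEquiv w hpP hpP2 hsurj (K := K) x‖ ≤ (p : ℝ) ^ n ↔ Valued.v x ≤ exp n := by
  induction x using UniformSpace.Completion.induction_on with
  | hp =>
    rw [Set.ext fun _ ↦ Iff.comm]
    have hy := valued_coe_natCast_zpow w hpP hpP2 (K := K) n
    simp_rw [← hy, ← Valuation.restrict_le_iff Valued.v]
    apply (withValUniformEquiv w hpP hpP2 hsurj (K := K)).toHomeomorph.isClosed_setOf_iff
      (q := fun z ↦ ‖z‖ ≤ (p : ℝ) ^ n)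
      (Valued.isClopen_closedBall _ (by rw [Ne, Valuation.restrict_eq_zero_iff, hy]; exact exp_ne_zero))
    simpa [Metric.closedBall] using IsUltrametricDist.isClopen_closedBall (0 : ℚ_[p])
      (zpow_ne_zero n (by exact_mod_cast hp.out.ne_zero : (p : ℝ) ≠ 0))
  | ih a =>
    rw [Valued.valuedCompletion_apply, withValRingEquiv_coe, ← WithVal.val_apply_equiv]
    exact (valuation_le_exp_iff w hpP hpP2 hsurj _ n).symm

/-- On the completion, `Padic.mulValuation (withValRingEquiv x) = Valued.v x`. -/
theorem mulValuation_withValRingEquiv (x : (w.valuation K).Completion) :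
    Padic.mulValuation (withValRingEquiv w hpP hpP2 hsurj (K := K) x) = Valued.v x := by
  apply eq_of_forall_le_exp_iff
  intro n
  rw [mulValuation_le_exp_iff, withValRingEquiv_norm_le_iff]

/-- THE VALUATIONS AGREE ON THE COMPLETION: the pull-back of the `p`-adic valuation of `ℚ_[p]`
along `withValRingEquiv` is the valuation of `(w.valuation K).Completion`. -/
theorem comap_mulValuation_withValRingEquiv :
    (Padic.mulValuation (p := p)).comap (withValRingEquiv w hpP hpP2 hsurj (K := K)).toRingHom =
      Valued.v := by
  ext x
  exact mulValuation_withValRingEquiv w hpP hpP2 hsurj x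

/-- On Mathlib's `w.adicCompletion K`: `Padic.mulValuation (adicCompletionRingEquiv x) = Valued.v x`. -/
theorem mulValuation_adicCompletionRingEquiv (x : w.adicCompletion K) :
    Padic.mulValuation (adicCompletionRingEquiv w hpP hpP2 hsurj (K := K) x) = Valued.v x := by
  rw [adicCompletionRingEquiv, RingEquiv.trans_apply, HeightOneSpectrum.adicCompletion.equiv_apply,
    mulValuation_withValRingEquiv, HeightOneSpectrum.adicCompletion.valued_toCompletion]

/-- `adicCompletionRingEquiv` is an isomorphism of valued fields: the pull-back of the `p`-adic
valuation along it is the `w`-adic valuation of `w.adicCompletion K`. -/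
theorem comap_mulValuation_adicCompletionRingEquiv :
    (Padic.mulValuation (p := p)).comap
      (adicCompletionRingEquiv w hpP hpP2 hsurj (K := K)).toRingHom = Valued.v := by
  ext x
  exact mulValuation_adicCompletionRingEquiv w hpP hpP2 hsurj x

/-- `‖adicCompletionRingEquiv x‖ ≤ p ^ n ↔ Valued.v x ≤ exp n`. -/
theorem adicCompletionRingEquiv_norm_le_iff (n : ℤ) (x : w.adicCompletion K) :
    ‖adicCompletionRingEquiv w hpP hpP2 hsurj (K := K) x‖ ≤ (p : ℝ) ^ n ↔ Valued.v x ≤ exp n := by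
  rw [← mulValuation_le_exp_iff, mulValuation_adicCompletionRingEquiv]

/-- The higher-unit balls correspond: `‖adicCompletionRingEquiv x - 1‖ ≤ p ^ n ↔ Valued.v (x - 1) ≤ exp n`
(for `n = -m ≤ 0`: `x ∈ 1 + 𝔭ᵐ` in the completion iff its image lies in `1 + pᵐ ℤ_[p]`). -/
theorem adicCompletionRingEquiv_norm_sub_one_le_iff (n : ℤ) (x : w.adicCompletion K) :
    ‖adicCompletionRingEquiv w hpP hpP2 hsurj (K := K) x - 1‖ ≤ (p : ℝ) ^ n ↔
      Valued.v (x - 1) ≤ exp n := by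
  rw [← map_one (adicCompletionRingEquiv w hpP hpP2 hsurj (K := K)), ← map_sub,
    adicCompletionRingEquiv_norm_le_iff]

/-- The norm of `F_𝔭` read through `ℚ_[p]`: `‖e x‖ = p ^ log (Valued.v x)` for `x ≠ 0`. -/
theorem norm_adicCompletionRingEquiv_eq_zpow_log (x : w.adicCompletion K) (hx : x ≠ 0) :
    ‖adicCompletionRingEquiv w hpP hpP2 hsurj (K := K) x‖ = (p : ℝ) ^ (log (Valued.v x)) := by
  rw [← mulValuation_adicCompletionRingEquiv w hpP hpP2 hsurj x]
  exact Padic.norm_eq_zpow_log_mulValuation ((map_ne_zero _).mpr hx)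

end Summit.Ventures.HodgeRepro2.T5DegreeOneValued

namespace Summit.Ventures.HodgeRepro2.T5DegreeOneValued

open IsDedekindDomain NumberField WithZero
open Summit.Ventures.HodgeRepro2.T5DegreeOneNumberField

variable {F : Type*} [Field F] [NumberField F] (w : HeightOneSpectrum (𝓞 F)) (p : ℕ)
  [hp : Fact p.Prime] [hw : w.asIdeal.LiesOver (Ideal.span {(p : ℤ)})]
  (hdeg : w.asIdeal.ramificationIdx ℤ * w.asIdeal.inertiaDeg ℤ = 1)
include hdeg

/-- `F_𝔭 ≃ ℚ_p` IS AN ISOMORPHISM OF VALUED FIELDS at a degree-one prime of a number field: the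
pull-back of the `p`-adic valuation of `ℚ_[p]` along `completionEquivPadic` is the `𝔭`-adic
valuation of Mathlib's `w.adicCompletion F`. -/
theorem comap_mulValuation_completionEquivPadic :
    (Padic.mulValuation (p := p)).comap (completionEquivPadic w p hdeg).toRingHom = Valued.v :=
  comap_mulValuation_adicCompletionRingEquiv w (natCast_mem w p) (natCast_notMem_sq w p hdeg)
    (exists_int_sub_mem w p hdeg)

/-- `Padic.mulValuation (completionEquivPadic x) = Valued.v x` on `F_𝔭`. -/
theorem mulValuation_completionEquivPadic (x : w.adicCompletion F) :
    Padic.mulValuation (completionEquivPadic w p hdeg x) = Valued.v x :=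
  mulValuation_adicCompletionRingEquiv w (natCast_mem w p) (natCast_notMem_sq w p hdeg)
    (exists_int_sub_mem w p hdeg) x

/-- `‖completionEquivPadic x‖ ≤ p ^ n ↔ Valued.v x ≤ exp n` on `F_𝔭`. -/
theorem completionEquivPadic_norm_le_iff (n : ℤ) (x : w.adicCompletion F) :
    ‖completionEquivPadic w p hdeg x‖ ≤ (p : ℝ) ^ n ↔ Valued.v x ≤ exp n :=
  adicCompletionRingEquiv_norm_le_iff w (natCast_mem w p) (natCast_notMem_sq w p hdeg)
    (exists_int_sub_mem w p hdeg) n x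

/-- The higher-unit balls of `F_𝔭` correspond to those of `ℚ_[p]`:
`‖completionEquivPadic x - 1‖ ≤ p ^ n ↔ Valued.v (x - 1) ≤ exp n`. -/
theorem completionEquivPadic_norm_sub_one_le_iff (n : ℤ) (x : w.adicCompletion F) :
    ‖completionEquivPadic w p hdeg x - 1‖ ≤ (p : ℝ) ^ n ↔ Valued.v (x - 1) ≤ exp n :=
  adicCompletionRingEquiv_norm_sub_one_le_iff w (natCast_mem w p) (natCast_notMem_sq w p hdeg)
    (exists_int_sub_mem w p hdeg) n x

/-- The norm of `F_𝔭` read through `ℚ_[p]`. -/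
theorem norm_completionEquivPadic_eq_zpow_log (x : w.adicCompletion F) (hx : x ≠ 0) :
    ‖completionEquivPadic w p hdeg x‖ = (p : ℝ) ^ (log (Valued.v x)) :=
  norm_adicCompletionRingEquiv_eq_zpow_log w (natCast_mem w p) (natCast_notMem_sq w p hdeg)
    (exists_int_sub_mem w p hdeg) x hx

end Summit.Ventures.HodgeRepro2.T5DegreeOneValued
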